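import Summits.KontsevichZagierPeriods.Zeta5Search.Barrier.ConeGammaLogCuspSlope

/-!
# ζ(5) search — BARRIER: the LOG-CUSP EXPANSION WITH ITS CONSTANTS WRITTEN OUT, at any admissible scale

HONEST FRAMING (cell `pub-zeta5`): systematic search; no irrationality claim unless kernel-certified. MODEL objects
under Brown–Zudilin's (28)+(30) accounting ([BZ22] = arXiv:2210.03391; (28) observed, not proved); nothing here is a
statement about `ζ(5)`, any `γ` of record, the cone's supremum (C2 = `BarrierC2` OPEN) or the value / sign of the cusp
slope at a named direction (DATA of the cell); the lemma S-E stays CONJECTURED; records in print UNMOVED. Prover P2 g37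
(P2 g36's successor menu (a) «Λ controls the saving to first order — the UNIFORM-in-δ remainder is the real item»),
file (1a) of three (theorems only).

THE POINT. P2 g19's log-cusp shape theorem `phi30_logCusp` / `phi30_logCusp_cuspSlope` gives, for EACH displacement
`δ` separately, constants `C(δ), ε₁(δ)` with `|Φ(s(a)+εδ) − Φ(s(a)) − (σ(δ)/T)·ε·log(1/ε)| ≤ C(δ)·ε` (`0 < ε ≤ ε₁(δ)`),
the constants hidden behind an existential. Its module docstring records as NOT proved «the size of `C` on a ball of
fixed radius». The constants of that proof depend on `δ` only through the shift size `Y(δ) = max_k |φ_k(δ)|` (cluster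
width `Y/x_min + 1`, cluster bound, `C₁ = 392·Y·(T·x_max + 5)/x_min`), the admissible scale `ρ` of Lemma B and
`|σ(δ)|`. ADAPTED COPY of the proof of `phi30_logCusp` (P2 g19, `ConeGammaLogCusp.lean`, p420705) with the admissible
scale an input and the constants explicit; reason: the accepted existential form cannot be instantiated uniformly in δ;
g19's file untouched and remains the cited pointwise form (lead/lit g40 ruling (1), INBOX 2026-08-28). This file re-runs
that proof ONCE with everything exposed:
* **`phi30_logCusp_explicit`** — at ANY admissible scale `ρ` of `δ` (`ρK(δ) < 1`, `ρK(δ) < d`, `2ρW(δ) ≤` every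
  breakpoint gap) and every `ε > 0` with `εT ≤ ρ/2`, `εT·Y(δ) ≤ 1`, `ε·Y(δ) ≤ x_min/2`, `s(a)+εδ` in the closed box:
  `|Φ(s(a)+εδ) − Φ(s(a)) − (cuspSlope a T δ / T)·ε·log(1/ε)| ≤ ((2x_max)²·T·C₁ + 4C₁/T + (|cuspSlope a T δ|/T)·(1 +
  log 2 + |log(ρ/T)|) + 14/ρ)·ε` (P2 g19's proof verbatim — head period, coherent periods against the harmonic number,
  tail, harmonic number against `log(1/ε)` — with the slope NAMED `cuspSlope a T δ` via `cuspSlope_spec`).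
Files (1b) `ConeGammaLogCuspUniform` (ONE admissible scale and ONE pair `C, ε₁` for all `Y(δ) ≤ Y₀`; the neighbourhood
form on a whole `Y`-ball) and (2) `ConeGammaCuspModulusLocal` (P2 g36's modulus `Λ` as the sharp coefficient; local
maximality on the slice) build on it. NOT here (honest): any value or sign of `σ`; the ball of S-E's radius `1/(2λ₀)`;
anything about `γ`, C2, `ζ(5)`.
-/

noncomputable section

open Set MeasureTheory
open scoped Topology

namespace Summit.KontsevichZagierPeriods.Zeta5Search.Barrier.ConeGamma

/-! ### The expansion with its constants written out, at any admissible scale -/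

/-- **THE LOG-CUSP EXPANSION WITH EXPLICIT CONSTANTS** (P2 g19's `phi30_logCusp`, constants read off). Let all 28
forms of `a` be positive, `a` in the closed box, `T > 0` a period, `δ` any displacement, `ρ > 0` ANY admissible scale
of Lemma B for `δ` (`ρK(δ) < 1`, `ρK(δ) < d`, `2ρW(δ) ≤` every breakpoint gap), and `ε > 0` with `εT ≤ ρ/2`,
`εT·Y(δ) ≤ 1`, `ε·Y(δ) ≤ x_min/2` and `s(a) + εδ` in the closed box. Then, with `C₁ = 392·Y(δ)·(T·x_max + 5)/x_min`,
`|Φ(s(a)+εδ) − Φ(s(a)) − (cuspSlope a T δ / T)·ε·log(1/ε)| ≤ ((2x_max)²·T·C₁ + 4C₁/T + (|cuspSlope a T δ|/T)·(1 +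
log 2 + |log(ρ/T)|) + 14/ρ)·ε`. (Head period, coherent periods against the harmonic number, tail `7/(KT)`, harmonic
number against `log(1/ε)` — the lead's desk-note decomposition, as in `ConeGammaLogCusp`.) -/
theorem phi30_logCusp_explicit {a : Dir} (ha : BZBox a) (hpos : ∀ k, 0 < h28 a k) {T : ℝ} (hT : 0 < T)
    (hper : ∀ k : Fin 28, ∃ z : ℤ, T * h28 a k = z) (δ : Fin 8 → ℝ) {ρ : ℝ} (hρ : 0 < ρ)
    (h1 : ρ * clusterBound a δ < 1) (h2 : ρ * clusterBound a δ < wallDist a T)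
    (hgap : ∀ m, m + 1 < (bkpts a T).card → 2 * ρ * clusterWidth a δ ≤ bkpt a T (m + 1) - bkpt a T m)
    {ε : ℝ} (hε : 0 < ε) (hεa : ε * T ≤ ρ / 2) (hεb : ε * T * shiftSize δ ≤ 1)
    (hεc : ε * shiftSize δ ≤ xMin a / 2) (haε : BZBox (aOfS (sParam a + ε • δ))) :
    |phi30 (aOfS (sParam a + ε • δ)) - phi30 a - cuspSlope a T δ / T * ε * Real.log (1 / ε)|
      ≤ ((2 * xMax a) ^ 2 * T * (392 * shiftSize δ * (T * xMax a + 5) / xMin a)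
          + 4 * (392 * shiftSize δ * (T * xMax a + 5) / xMin a) / T
          + |cuspSlope a T δ| / T * (1 + Real.log 2 + |Real.log (ρ / T)|) + 14 / ρ) * ε := by
  -- the slope, named
  obtain ⟨σ, hσdef⟩ : ∃ σ : ℝ, σ = cuspSlope a T δ := ⟨_, rfl⟩
  rw [← hσdef]
  have hσ : (translateIntegral a T (ρ • δ) - translateIntegral a T 0) / ρ = σ := by
    rw [hσdef, cuspSlope_spec hpos hT hper δ hρ h1 h2 hgap]
    field_simp
  -- constants (opaque names with defining equations)
  have hY0 : 0 ≤ shiftSize δ := shiftSize_nonneg δ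
  have hxm := xMin_pos hpos
  have hxM := xMax_pos hpos
  obtain ⟨C₁, hC₁⟩ : ∃ C₁ : ℝ, C₁ = 392 * shiftSize δ * (T * xMax a + 5) / xMin a := ⟨_, rfl⟩
  have hC₁nn : 0 ≤ C₁ := by
    rw [hC₁]; exact div_nonneg (mul_nonneg (mul_nonneg (by norm_num) hY0) (by nlinarith)) hxm.le
  obtain ⟨Clog, hClog⟩ : ∃ Clog : ℝ, Clog = 1 + Real.log 2 + |Real.log (ρ / T)| := ⟨_, rfl⟩
  obtain ⟨C, hC⟩ : ∃ C : ℝ, C = (2 * xMax a) ^ 2 * T * C₁ + 4 * C₁ / T + |σ| / T * Clog + 14 / ρ := ⟨_, rfl⟩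
  rw [← hC₁, ← hClog, ← hC]
  have hρY : ρ * shiftSize δ ≤ 1 :=
    ((mul_le_mul_of_nonneg_left (shiftSize_le_clusterBound hpos δ) hρ.le).trans h1.le)
  -- the number of coherent periods
  obtain ⟨K, hK⟩ : ∃ K : ℕ, K = ⌊ρ / (ε * T)⌋₊ := ⟨_, rfl⟩
  have hεT : 0 < ε * T := mul_pos hε hT
  have hx2 : (2 : ℝ) ≤ ρ / (ε * T) := by rw [le_div_iff₀ hεT]; linarith
  have hK2 : 2 ≤ K := by rw [hK]; exact Nat.le_floor (by exact_mod_cast hx2)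
  have hK2r : (2 : ℝ) ≤ K := by exact_mod_cast hK2
  have hKle : (K : ℝ) ≤ ρ / (ε * T) := by rw [hK]; exact Nat.floor_le (div_nonneg hρ.le hεT.le)
  have hKge : ρ / (ε * T) - 1 ≤ K := by
    have := Nat.lt_floor_add_one (ρ / (ε * T)); rw [← hK] at this; linarith
  have hKT : 0 < (K : ℝ) * T := mul_pos (by linarith) hT
  have hεKT : ε * (K * T) ≤ ρ := by
    have := mul_le_mul_of_nonneg_left hKle hεT.le
    rw [mul_div_cancel₀ _ hεT.ne'] at this; linarith
  -- the integrand in torus form and its integrability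
  obtain ⟨g, hg⟩ : ∃ g : ℝ → ℝ,
      g = fun u => ((torusN (u • sParam a + (u * ε) • δ) : ℝ) - torusN (u • sParam a)) / u ^ 2 := ⟨_, rfl⟩
  have hF : phi30 (aOfS (sParam a + ε • δ)) - phi30 a = ∫ u in Ioi 0, g u := by
    unfold phi30
    rw [← integral_sub (integrableOn_savingN_div_sq haε) (integrableOn_savingN_div_sq ha)]
    refine setIntegral_congr_fun measurableSet_Ioi fun u _ => ?_
    simp only [hg, savingN_perturb_eq_torusN δ ε u haε, savingN_eq_torusN_of_BZBox ha, sub_div]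
  have hgint : IntegrableOn g (Ioi 0) := by
    have h := (integrableOn_savingN_div_sq haε).sub (integrableOn_savingN_div_sq ha)
    refine h.congr_fun (fun u _ => ?_) measurableSet_Ioi
    simp only [hg, Pi.sub_apply, savingN_perturb_eq_torusN δ ε u haε, savingN_eq_torusN_of_BZBox ha, sub_div]
  -- split `(0, ∞) = (0, KT] ∪ (KT, ∞)` and `(0, KT]` into periods
  have hsplit : ∫ u in Ioi 0, g u = (∫ u in (0 : ℝ)..(K * T), g u) + ∫ u in Ioi (K * T), g u := by
    rw [← Ioc_union_Ioi_eq_Ioi hKT.le, setIntegral_union Ioc_disjoint_Ioi_same measurableSet_Ioi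
      (hgint.mono_set Ioc_subset_Ioi_self) (hgint.mono_set (Ioi_subset_Ioi hKT.le)),
      intervalIntegral.integral_of_le hKT.le]
  have hperiods : ∫ u in (0 : ℝ)..(K * T), g u
      = ∑ k ∈ Finset.range K, ∫ u in ((k : ℝ) * T)..(((k : ℝ) + 1) * T), g u := by
    have h := intervalIntegral.sum_integral_adjacent_intervals (a := fun k : ℕ => (k : ℝ) * T) (n := K)
      (f := g) (μ := volume) fun k _ => ?_
    · simp only [Nat.cast_zero, zero_mul] at h
      rw [← h]
      refine Finset.sum_congr rfl fun k _ => ?_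
      push_cast; rfl
    · have hk0 : (0 : ℝ) ≤ k * T := mul_nonneg (Nat.cast_nonneg k) hT.le
      rw [intervalIntegrable_iff_integrableOn_Ioc_of_le (by push_cast; nlinarith)]
      exact hgint.mono_set fun u hu => lt_of_le_of_lt hk0 hu.1
  -- head + coherent periods
  obtain ⟨K', hK'⟩ : ∃ K', K = K' + 1 := ⟨K - 1, by omega⟩
  have hsumsplit : ∑ k ∈ Finset.range K, (∫ u in ((k : ℝ) * T)..(((k : ℝ) + 1) * T), g u)
      = (∑ j ∈ Finset.range K', ∫ u in (((j : ℝ) + 1) * T)..(((j : ℝ) + 1 + 1) * T), g u)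
        + ∫ u in (0 : ℝ)..T, g u := by
    rw [hK', Finset.sum_range_succ']
    simp only [Nat.cast_add, Nat.cast_one, Nat.cast_zero, zero_mul, zero_add, one_mul]
  -- (i) the head
  have hhead : |∫ u in (0 : ℝ)..T, g u| ≤ (2 * xMax a) ^ 2 * ((ε * T) * C₁) := by
    rw [hg, hC₁]
    exact abs_head_integral_le hpos hT δ hε.le hεb hεc
  -- (ii) each coherent period `k = j + 1 ≤ K − 1`
  have hP : ∀ j : ℕ, j < K' →
      |(∫ u in (((j : ℝ) + 1) * T)..(((j : ℝ) + 1 + 1) * T), g u) - ε * σ / (((j : ℝ) + 1) * T)|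
        ≤ (ε * C₁ / T) * (4 / (((j : ℝ) + 1) * ((j : ℝ) + 1 + 1))) := by
    intro j hj
    have hjK : (j : ℝ) + 1 ≤ K := by
      have hj' : (j : ℝ) + 1 ≤ K' := by exact_mod_cast hj
      rw [hK']; push_cast; linarith only [hj']
    have hj1 : ((j : ℝ) + 1) * T ≤ K * T := mul_le_mul_of_nonneg_right hjK hT.le
    have hj0 : (0 : ℝ) < (j : ℝ) + 1 := Nat.cast_add_one_pos j
    have hρ'pos : 0 < ε * (((j : ℝ) + 1) * T) := mul_pos hε (mul_pos hj0 hT)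
    have hρ'le : ε * (((j : ℝ) + 1) * T) ≤ ρ := (mul_le_mul_of_nonneg_left hj1 hε.le).trans hεKT
    have hkY : ε * (((j : ℝ) + 1) * T) * shiftSize δ ≤ 1 :=
      (mul_le_mul_of_nonneg_right hρ'le hY0).trans hρY
    have hper_k := abs_period_integral_sub_translate_le hpos hT hper δ hε.le hεb (k := j + 1) (by omega)
      (by push_cast; exact hkY)
    push_cast at hper_k
    have hB := translateIntegral_shift_eq_slope hpos hT hper δ hρ'pos hρ'le h1 h2 hgap
    rw [hσ] at hB
    rw [hB, show ε * (((j : ℝ) + 1) * T) * σ / (((j : ℝ) + 1) * T) ^ 2 = ε * σ / (((j : ℝ) + 1) * T) by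
      field_simp] at hper_k
    rw [hg, hC₁]
    have hjnn : (0 : ℝ) ≤ (j : ℝ) := Nat.cast_nonneg j
    exact hper_k.trans (period_error_le hε.le hT (hC₁ ▸ hC₁nn) (by linarith only [hjnn]))
  -- (iii) the sum over the coherent periods against the harmonic number
  have hsum : |(∑ j ∈ Finset.range K', ∫ u in (((j : ℝ) + 1) * T)..(((j : ℝ) + 1 + 1) * T), g u)
      - ε * σ / T * ((harmonic K' : ℚ) : ℝ)| ≤ 4 * (ε * C₁ / T) := by
    rw [harmonic_cast_eq_sum, Finset.mul_sum, ← Finset.sum_sub_distrib]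
    refine (Finset.abs_sum_le_sum_abs _ _).trans ?_
    have hterm : ∀ j ∈ Finset.range K',
        |(∫ u in (((j : ℝ) + 1) * T)..(((j : ℝ) + 1 + 1) * T), g u) - ε * σ / T * (1 / ((j : ℝ) + 1))|
          ≤ (ε * C₁ / T) * (4 / (((j : ℝ) + 1) * ((j : ℝ) + 1 + 1))) := by
      intro j hj
      rw [show ε * σ / T * (1 / ((j : ℝ) + 1)) = ε * σ / (((j : ℝ) + 1) * T) by field_simp]
      exact hP j (Finset.mem_range.mp hj)
    refine (Finset.sum_le_sum hterm).trans ?_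
    rw [← Finset.mul_sum]
    have h4 : ∑ j ∈ Finset.range K', 4 / (((j : ℝ) + 1) * ((j : ℝ) + 1 + 1))
        = 4 * ∑ j ∈ Finset.range K', 1 / (((j : ℝ) + 1) * ((j : ℝ) + 2)) := by
      rw [Finset.mul_sum]
      refine Finset.sum_congr rfl fun j _ => ?_
      rw [show (j : ℝ) + 1 + 1 = (j : ℝ) + 2 by ring]
      field_simp
    rw [h4]
    have hs := sum_range_inv_mul_succ_le_one K'
    have hpos' : 0 ≤ ε * C₁ / T := div_nonneg (mul_nonneg hε.le hC₁nn) hT.le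
    have := mul_le_mul_of_nonneg_left hs hpos'
    linarith only [this]
  -- (iv) the tail
  have htail : |∫ u in Ioi ((K : ℝ) * T), g u| ≤ 14 * ε / ρ := by
    rw [hg]
    refine (abs_tail_integral_le a δ ε hKT).trans ?_
    have hKT2 : ρ / (2 * ε) ≤ K * T := by
      have h : ρ / (ε * T) / 2 ≤ K := by linarith only [hKge, hx2]
      have := mul_le_mul_of_nonneg_right h hT.le
      calc ρ / (2 * ε) = ρ / (ε * T) / 2 * T := by field_simp
        _ ≤ K * T := this
    calc 7 / ((K : ℝ) * T) ≤ 7 / (ρ / (2 * ε)) :=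
          div_le_div_of_nonneg_left (by norm_num) (div_pos hρ (by linarith only [hε])) hKT2
      _ = 14 * ε / ρ := by field_simp; ring
  -- (v) harmonic number against `log (1/ε)`
  have hlog : |((harmonic K' : ℚ) : ℝ) - Real.log (1 / ε)| ≤ Clog := by
    have hKK : K - 1 = K' := by omega
    obtain ⟨hl, hu⟩ := log_le_harmonic_pred_le hK2
    rw [hKK] at hl hu
    have hKpos : (0 : ℝ) < K := by linarith only [hK2r]
    have hlogK_le : Real.log K ≤ Real.log (1 / ε) + Real.log (ρ / T) := by
      have h := Real.log_le_log hKpos hKle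
      rw [Real.log_div hρ.ne' hεT.ne', Real.log_mul hε.ne' hT.ne'] at h
      rw [Real.log_div one_ne_zero hε.ne', Real.log_one, Real.log_div hρ.ne' hT.ne']
      linarith only [h]
    have hlogK_ge : Real.log (1 / ε) + Real.log (ρ / T) - Real.log 2 ≤ Real.log K := by
      have hx : ρ / (ε * T) / 2 ≤ K := by linarith only [hKge, hx2]
      have h := Real.log_le_log (div_pos (div_pos hρ hεT) two_pos) hx
      rw [Real.log_div (div_pos hρ hεT).ne' two_ne_zero, Real.log_div hρ.ne' hεT.ne',
        Real.log_mul hε.ne' hT.ne'] at h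
      rw [Real.log_div one_ne_zero hε.ne', Real.log_one, Real.log_div hρ.ne' hT.ne']
      linarith only [h]
    have hlog2 : 0 < Real.log 2 := Real.log_pos one_lt_two
    rw [hClog, abs_le]
    constructor
    · have h := neg_abs_le (Real.log (ρ / T)); linarith only [h, hl, hlogK_ge, hlog2]
    · have h := le_abs_self (Real.log (ρ / T)); linarith only [h, hu, hlogK_le, hlog2]
  -- (vi) assemble: a purely algebraic combination of (i)–(v)
  have key : ∀ I₀ S Tl H Λ : ℝ, |I₀| ≤ (2 * xMax a) ^ 2 * ((ε * T) * C₁) →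
      |S - ε * σ / T * H| ≤ 4 * (ε * C₁ / T) → |Tl| ≤ 14 * ε / ρ → |H - Λ| ≤ Clog →
      |S + I₀ + Tl - σ / T * ε * Λ| ≤ C * ε := by
    intro I₀ S Tl H Λ hI hS hTl hH
    have hdecomp : S + I₀ + Tl - σ / T * ε * Λ = I₀ + (S - ε * σ / T * H) + ε * σ / T * (H - Λ) + Tl := by
      ring
    have hmid : |ε * σ / T * (H - Λ)| ≤ ε * (|σ| / T * Clog) := by
      rw [abs_mul, show |ε * σ / T| = ε * (|σ| / T) by
        rw [abs_div, abs_mul, abs_of_pos hε, abs_of_pos hT]; ring]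
      rw [mul_assoc]
      exact mul_le_mul_of_nonneg_left (mul_le_mul_of_nonneg_left hH (div_nonneg (abs_nonneg σ) hT.le)) hε.le
    rw [hdecomp]
    calc |I₀ + (S - ε * σ / T * H) + ε * σ / T * (H - Λ) + Tl|
        ≤ |I₀| + |S - ε * σ / T * H| + |ε * σ / T * (H - Λ)| + |Tl| :=
          (abs_add_le _ _).trans (add_le_add ((abs_add_le _ _).trans
            (add_le_add (abs_add_le _ _) le_rfl)) le_rfl)
      _ ≤ (2 * xMax a) ^ 2 * ((ε * T) * C₁) + 4 * (ε * C₁ / T) + ε * (|σ| / T * Clog) + 14 * ε / ρ :=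
          add_le_add (add_le_add (add_le_add hI hS) hmid) hTl
      _ = C * ε := by rw [hC]; field_simp
  rw [hF, hsplit, hperiods, hsumsplit]
  exact key (∫ u in (0 : ℝ)..T, g u)
    (∑ j ∈ Finset.range K', ∫ u in (((j : ℝ) + 1) * T)..(((j : ℝ) + 1 + 1) * T), g u)
    (∫ u in Ioi ((K : ℝ) * T), g u) ((harmonic K' : ℚ) : ℝ) (Real.log (1 / ε)) hhead hsum htail hlog


end Summit.KontsevichZagierPeriods.Zeta5Search.Barrier.ConeGamma

end
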